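import Summits.AtomisticToContinuum.HydrodynamicLimit.Theses.ChapmanEnskogBBGKY

/-!
# Strategy-census signatures for crux `LocalMaxwellianInMean` (stmt-AtomisticToContinuum-11891)

Typed statements referred to in `STRATEGY-CENSUS.md` (crux-strategist REDIRECT r1, 2026-08-17).
They are NOT route items and NOT a registered line: they document the census attempts
(`## Strengthen`, `## Decomposition`, `## Transfer`) as elaborating Props over existing declarations.
Every `def` below copies the binder prefix and the `let`-bound objects of the crux verbatim
(`Theses/ChapmanEnskogBBGKY.lean`, decl `LocalMaxwellianInMean`), so that implications between them
and the crux ζ-reduce to one family of terms.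
-/

namespace Summit.AtomisticToContinuum.HydrodynamicLimit.Cruxes.LocalMaxwellianInMean.Census

open scoped BigOperators Topology Classical MeasureTheory InnerProductSpace
open Filter Set Function MeasureTheory
open Summit.AtomisticToContinuum.HydrodynamicLimit.Theses.ChapmanEnskogBBGKY

/-- STRENGTHEN (S⁺). **Pre-collisional molecular chaos at contact in the mean, time-averaged, with
cubic weights.** Same setting as the crux; `F2 N s` = two-body marginal of the transported canonical
density. On the PRE-COLLISIONAL half of the contact manifold (partner at `x + ε_N ω`, approaching:
`⟪ω, v₁ - v⟫ < 0`, weight `(-⟪ω, v₁ - v⟫)₊` — exactly the configurations at which both the gain and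
the loss term of `hsCollisionTerm` (GST 2013 (4.3.6)) evaluate their argument), the weighted L¹
defect between `F2` and the Enskog closure `Y(σ³ρ_s(midpoint))·F¹⊗F¹` vanishes in time integral.
This is the Boltzmann–Enskog hypothesis ("Stosszahlansatz" with the equilibrium contact factor) for
the true hard-sphere evolution at fixed reduced density over Euler times; with the free first-BBGKY
identity (`FreeCollisionIdentity`) and mean cubic moments it gives the crux
(`chaos_route` below is the typed implication). -/
def PreCollisionalChaosAtContact : Prop :=
  ∀ (a₀ θ₀ : Literature.MathematicalPhysics.KineticTheory.T3 → ℝ) (u₀ : Literature.MathematicalPhysics.KineticTheory.T3 → Literature.MathematicalPhysics.KineticTheory.V3), Continuous a₀ → Continuous θ₀ → Continuous u₀ → (∀ x, 0 < a₀ x) → (∀ x, 0 < θ₀ x) → ∃ σ₀ : ℝ, 0 < σ₀ ∧ ∀ σ : ℝ, 0 < σ → σ < σ₀ → ∀ (T : ℝ) (ρ θ : ℝ → Literature.MathematicalPhysics.KineticTheory.T3 → ℝ) (u : ℝ → Literature.MathematicalPhysics.KineticTheory.T3 → Literature.MathematicalPhysics.KineticTheory.V3), Literature.MathematicalPhysics.KineticTheory.IsHardSphereEulerSolution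 σ T ρ u θ → ∀ Φ : (N : ℕ) → Literature.Analysis.FluidPDE.HardSphereFlow (Literature.Analysis.FluidPDE.Torus.geometry (Fin 3)) (Literature.MathematicalPhysics.KineticTheory.hsDiameter σ N) (N + 1), (∀ N, Measurable (fun p : ℝ × Literature.Analysis.FluidPDE.Config (N + 1) (Fin 3) Literature.MathematicalPhysics.KineticTheory.T3 => (Φ N).flow p.1 p.2)) → Literature.MathematicalPhysics.KineticTheory.TendstoHydroFieldsAt (fun N => Literature.MathematicalPhysics.KineticTheory.localGibbsLaw σ a₀ u₀ θ₀ N (Φ N)) Φ ρ u θ 0 → ∀ t ∈ Set.Ico 0 T,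
    let G : Literature.Analysis.FluidPDE.Geometry (Fin 3) Literature.MathematicalPhysics.KineticTheory.T3 := Literature.Analysis.FluidPDE.Torus.geometry (Fin 3)
    let ε : ℕ → ℝ := fun N => Literature.MathematicalPhysics.KineticTheory.hsDiameter σ N
    let W : (N : ℕ) → ℝ → Literature.Analysis.FluidPDE.Config (N + 1) (Fin 3) Literature.MathematicalPhysics.KineticTheory.T3 → ℝ := fun N s => (Literature.Analysis.FluidPDE.hardSphereDomain G (N + 1) (ε N)).indicator (Literature.Analysis.FluidPDE.hsTransport (Φ N) s (Literature.Analysis.FluidPDE.canonicalDensity G (ε N) (N + 1) (Literature.MathematicalPhysics.KineticTheory.localGibbsProfile a₀ u₀ θ₀)))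
    let F1 : ℕ → ℝ → Literature.MathematicalPhysics.KineticTheory.T3 × Literature.MathematicalPhysics.KineticTheory.V3 → ℝ := fun N s y => Literature.Analysis.FluidPDE.nthMarginal (N + 1) 1 (W N s) (fun _ => y)
    let F2 : ℕ → ℝ → Literature.Analysis.FluidPDE.Config 2 (Fin 3) Literature.MathematicalPhysics.KineticTheory.T3 → ℝ := fun N s Z => Literature.Analysis.FluidPDE.nthMarginal (N + 1) 2 (W N s) Z
    let Y : ℝ → ℝ := fun η => if η = 0 then 1 else (Literature.MathematicalPhysics.KineticTheory.hsCompressibility η - 1) / (2 * Real.pi / 3 * η)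
    let clos : ℝ → (Literature.MathematicalPhysics.KineticTheory.T3 × Literature.MathematicalPhysics.KineticTheory.V3 → ℝ) → Literature.Analysis.FluidPDE.Config (2) (Fin 3) Literature.MathematicalPhysics.KineticTheory.T3 → ℝ := fun s f Z => Y (σ ^ 3 * ρ s (G.translate (Z 0).1 ((1 / 2 : ℝ) • G.sepVec (Z 1).1 (Z 0).1))) * f (Z 0) * f (Z 1)
    let Dpre : ℕ → ENNReal := fun N => ∫⁻ s in Set.Ioo 0 t, ∫⁻ x : Literature.MathematicalPhysics.KineticTheory.T3, ∫⁻ ω : Metric.sphere (0 : Literature.MathematicalPhysics.KineticTheory.V3) 1, (∫⁻ v : Literature.MathematicalPhysics.KineticTheory.V3, ∫⁻ v₁ : Literature.MathematicalPhysics.KineticTheory.V3, ENNReal.ofReal ((1 + ‖v‖ ^ 2 + ‖v₁‖ ^ 2) * max (-(inner ℝ (ω : Literature.MathematicalPhysics.KineticTheory.V3) (v₁ - v))) 0 * |F2 N s (Literature.Analysis.FluidPDE.lossConfig G (ε N) (fun _ : Fin 1 => (x, v)) 0 (ω : Literature.MathematicalPhysics.KineticTheory.V3) v₁) - clos s (F1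 N s) (Literature.Analysis.FluidPDE.lossConfig G (ε N) (fun _ : Fin 1 => (x, v)) 0 (ω : Literature.MathematicalPhysics.KineticTheory.V3) v₁)|)) ∂Literature.MathematicalPhysics.KineticTheory.sphereMeasure
    Filter.Tendsto Dpre Filter.atTop (nhds 0)

/-- TRANSFER (the free identity the Boltzmann-sibling argument would need as its starting point).
**Weak first-BBGKY identity, rate-free form: the time-integrated collision functional of the TRUE
two-body marginal vanishes.** `E[avg φ(t)] − E[avg φ(0)] − ∫₀ᵗ E[avg Dφ] = N ε_N² ∫₀ᵗ∫ φ · hsCollisionTerm(F2)`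
and the left side is `O(1)` by mean quadratic/cubic moments, so the rate-free functional is
`O(1/(N ε_N²)) = O(N^{-1/3})`. Stated directly as the vanishing of the rate-free functional of `F2`
for every continuous weight of quadratic growth. (Kinematics of the hard-sphere flow + moments; no
chaos. For collision-invariant weights it is the `O(ε)` collisional-transfer term divided by the rate.) -/
def FreeCollisionIdentity : Prop :=
  ∀ (a₀ θ₀ : Literature.MathematicalPhysics.KineticTheory.T3 → ℝ) (u₀ : Literature.MathematicalPhysics.KineticTheory.T3 → Literature.MathematicalPhysics.KineticTheory.V3), Continuous a₀ → Continuous θ₀ → Continuous u₀ → (∀ x, 0 < a₀ x) → (∀ x, 0 < θ₀ x) → ∃ σ₀ : ℝ, 0 < σ₀ ∧ ∀ σ : ℝ, 0 < σ → σ < σ₀ → ∀ (T : ℝ) (ρ θ : ℝ → Literature.MathematicalPhysics.KineticTheory.T3 → ℝ) (u : ℝ → Literature.MathematicalPhysics.KineticTheory.T3 → Literature.MathematicalPhysics.KineticTheory.V3), Literature.MathematicalPhysics.KineticTheory.IsHardSphereEulerSolution σ T ρ u θ → ∀ Φ : (N : ℕ) → Literature.Analysis.FluidPDE.HardSphereFlow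 (Literature.Analysis.FluidPDE.Torus.geometry (Fin 3)) (Literature.MathematicalPhysics.KineticTheory.hsDiameter σ N) (N + 1), (∀ N, Measurable (fun p : ℝ × Literature.Analysis.FluidPDE.Config (N + 1) (Fin 3) Literature.MathematicalPhysics.KineticTheory.T3 => (Φ N).flow p.1 p.2)) → Literature.MathematicalPhysics.KineticTheory.TendstoHydroFieldsAt (fun N => Literature.MathematicalPhysics.KineticTheory.localGibbsLaw σ a₀ u₀ θ₀ N (Φ N)) Φ ρ u θ 0 → ∀ t ∈ Set.Ico 0 T, ∀ φ : ℝ → Literature.MathematicalPhysics.KineticTheory.T3 × Literature.MathematicalPhysics.KineticTheory.V3 → ℝ, Continuous (fun p : ℝ × (Literature.MathematicalPhysics.KineticTheory.T3 × Literature.MathematicalPhysics.KineticTheory.V3) => φ p.1 p.2) → (∀ s y, |φ s y| ≤ 1 + ‖y.2‖ ^ 2) →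
    let G : Literature.Analysis.FluidPDE.Geometry (Fin 3) Literature.MathematicalPhysics.KineticTheory.T3 := Literature.Analysis.FluidPDE.Torus.geometry (Fin 3)
    let ε : ℕ → ℝ := fun N => Literature.MathematicalPhysics.KineticTheory.hsDiameter σ N
    let W : (N : ℕ) → ℝ → Literature.Analysis.FluidPDE.Config (N + 1) (Fin 3) Literature.MathematicalPhysics.KineticTheory.T3 → ℝ := fun N s => (Literature.Analysis.FluidPDE.hardSphereDomain G (N + 1) (ε N)).indicator (Literature.Analysis.FluidPDE.hsTransport (Φ N) s (Literature.Analysis.FluidPDE.canonicalDensity G (ε N) (N + 1) (Literature.MathematicalPhysics.KineticTheory.localGibbsProfile a₀ u₀ θ₀)))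
    let F2 : ℕ → ℝ → Literature.Analysis.FluidPDE.Config 2 (Fin 3) Literature.MathematicalPhysics.KineticTheory.T3 → ℝ := fun N s Z => Literature.Analysis.FluidPDE.nthMarginal (N + 1) 2 (W N s) Z
    Filter.Tendsto (fun N : ℕ => ∫ s in (0 : ℝ)..t, ∫ y, φ s y * Literature.Analysis.FluidPDE.hsCollisionTerm G (ε N) 1 0 (F2 N s) (fun _ => y)) Filter.atTop (nhds 0)

/-- DECOMPOSITION, piece (A). **Velocity-sector Maxwellianity of the one-body marginal in weighted L¹,
time-integrated** — the one-point functional of the strategist split of `ContactBilinearEntropyBound`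
(item 17607's `S^vel`, here in plain L¹ form and with conclusion `→ 0`): the cubic-weighted L¹_v
deviation of `F¹_N(s, x, ·)` from the Maxwellian with ITS OWN density `ρ_F = ∫F¹ dv` and Euler's
`(u_s, θ_s)` vanishes after integration over `(0,t) × 𝕋³`. Strictly STRONGER than what the crux needs
(strong-form local Maxwellianity, Euler's velocity/temperature), and implied by the route target
`RelEntropyVanishing` together with a sixth-moment / Gaussian tail bound (exact velocity chain rule
`(N+1)·KL(F¹ ‖ ρ_F ⊗ M_{u,θ}) ≤ klDiv(law ‖ local Gibbs)` + weighted Csiszár–Kullback–Pinsker). -/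
def VelocityMaxwellianityInMean : Prop :=
  ∀ (a₀ θ₀ : Literature.MathematicalPhysics.KineticTheory.T3 → ℝ) (u₀ : Literature.MathematicalPhysics.KineticTheory.T3 → Literature.MathematicalPhysics.KineticTheory.V3), Continuous a₀ → Continuous θ₀ → Continuous u₀ → (∀ x, 0 < a₀ x) → (∀ x, 0 < θ₀ x) → ∃ σ₀ : ℝ, 0 < σ₀ ∧ ∀ σ : ℝ, 0 < σ → σ < σ₀ → ∀ (T : ℝ) (ρ θ : ℝ → Literature.MathematicalPhysics.KineticTheory.T3 → ℝ) (u : ℝ → Literature.MathematicalPhysics.KineticTheory.T3 → Literature.MathematicalPhysics.KineticTheory.V3), Literature.MathematicalPhysics.KineticTheory.IsHardSphereEulerSolution σ T ρ u θ → ∀ Φ : (N : ℕ) → Literature.Analysis.FluidPDE.HardSphereFlow (Literature.Analysis.FluidPDE.Torus.geometry (Fin 3)) (Literature.MathematicalPhysics.KineticTheory.hsDiameter σ N) (N + 1), (∀ N, Measurable (fun p : ℝ × Literature.Analysis.FluidPDE.Config (N + 1) (Fin 3) Literature.MathematicalPhysics.KineticTheory.T3 => (Φ N).flow p.1 p.2))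 → Literature.MathematicalPhysics.KineticTheory.TendstoHydroFieldsAt (fun N => Literature.MathematicalPhysics.KineticTheory.localGibbsLaw σ a₀ u₀ θ₀ N (Φ N)) Φ ρ u θ 0 → ∀ t ∈ Set.Ico 0 T,
    let G : Literature.Analysis.FluidPDE.Geometry (Fin 3) Literature.MathematicalPhysics.KineticTheory.T3 := Literature.Analysis.FluidPDE.Torus.geometry (Fin 3)
    let ε : ℕ → ℝ := fun N => Literature.MathematicalPhysics.KineticTheory.hsDiameter σ N
    let W : (N : ℕ) → ℝ → Literature.Analysis.FluidPDE.Config (N + 1) (Fin 3) Literature.MathematicalPhysics.KineticTheory.T3 → ℝ := fun N s => (Literature.Analysis.FluidPDE.hardSphereDomain G (N + 1) (ε N)).indicator (Literature.Analysis.FluidPDE.hsTransport (Φ N) s (Literature.Analysis.FluidPDE.canonicalDensity G (ε N) (N + 1) (Literature.MathematicalPhysics.KineticTheory.localGibbsProfile a₀ u₀ θ₀)))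
    let F1 : ℕ → ℝ → Literature.MathematicalPhysics.KineticTheory.T3 × Literature.MathematicalPhysics.KineticTheory.V3 → ℝ := fun N s y => Literature.Analysis.FluidPDE.nthMarginal (N + 1) 1 (W N s) (fun _ => y)
    let w : Literature.MathematicalPhysics.KineticTheory.V3 → ℝ := fun v => (1 + ‖v‖ ^ 2) * (1 + ‖v‖)
    let ρF : ℕ → ℝ → Literature.MathematicalPhysics.KineticTheory.T3 → ℝ := fun N s x => ∫ v, F1 N s (x, v)
    let Svel : ℕ → ENNReal := fun N => ∫⁻ s in Set.Ioo 0 t, ∫⁻ x : Literature.MathematicalPhysics.KineticTheory.T3, ∫⁻ v : Literature.MathematicalPhysics.KineticTheory.V3, ENNReal.ofReal (w v * |F1 N s (x, v) - ρF N s x * Literature.Analysis.FluidPDE.localMaxwellian 1 (θ s x) (u s x) v|)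
    Filter.Tendsto Svel Filter.atTop (nhds 0)

/-- DECOMPOSITION, piece (K) (kinematics/analysis only, no dynamics; the honest "glue" of the best
split found): weighted-L¹ local Maxwellianity (A) plus a Gaussian majorant of the one-body marginal
(the route's open support `OneBodyGaussianBound`, supplying `ρ_F ∈ L∞_x` and all velocity moments
pointwise in `x`) imply the crux: `|∫φ·Q_E^{Y,ε}(F¹,F¹)| ≤ |∫φ·Q_E^{Y,ε}(M̃,M̃)| + C·(Gaussian moment
bound)·∫ w|F¹ − M̃|`, `M̃ = ρ_F M_{u_s,θ_s}`, and `∫φ·Q_E^{Y,ε}(M̃,M̃) → 0` by joint continuity of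
`(u, θ)` on `[0,t] × 𝕋³` (uniformly in `x, ω`: `M_{x+εω} → M_x`), `‖ρ_F‖_∞ ≤ K` and torus translation
invariance (`∫∫ρ_F(x)ρ_F(x+εω) ≤ |S²|‖ρ_F‖₂²`); `Y ∘ (σ³ρ_s)` bounded on the compact range by
`HsEosLowDensity` for `σ < σ₀`. Size L–XL in Lean (parametric Bochner/Tonelli bookkeeping of
`nthMarginal`). -/
def KinematicMaxwellianReduction : Prop :=
  VelocityMaxwellianityInMean → OneBodyGaussianBound → LocalMaxwellianInMean

/-- STRENGTHEN, typed: the Boltzmann–Enskog hypothesis route to the crux. Free identity + pre-collisional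
chaos (S⁺) + mean cubic moments (uniform integrability of the cubic-weighted contact functional)
⇒ `LocalMaxwellianInMean`: `∫φ·C(Y F¹⊗F¹) = ∫φ·C(F2) − ∫φ·C(F2 − Y F¹⊗F¹)`, first term `→ 0`
(free identity), second `≤ Dpre → 0` (`|φ| ≤ 1 + ‖v‖²`, `(ω·(v₁−v))₊ ≤ ‖v−v₁‖`-type weights absorbed in
the cubic weight of `Dpre`). The load-bearing hypothesis is S⁺, which is Lanford's theorem at
POSITIVE reduced density over `N^{1/3}` mean free times — no technique (census § Strengthen). -/
def ChaosRoute : Prop :=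
  FreeCollisionIdentity → PreCollisionalChaosAtContact → CubicMomentsInMean → LocalMaxwellianInMean

/-- DOMINATION (the costume, typed one level up): the route's own summit-implying TARGET plus its open
Gaussian-tail support give the crux — `RelEntropyVanishing → OneBodyGaussianBound →
LocalMaxwellianInMean` — through (A): `(N+1)·KL(F¹_N(s) ‖ ρ_F ⊗ M_{u_s,θ_s}) ≤ klDiv(law_s ‖ localGibbs(a_s,u_s,θ_s))`
for ANY activity `a_s` (velocities are conditionally independent Maxwellians given positions under a
hard-core local Gibbs law), weighted CKP with the Gaussian majorant, dominated convergence in `s`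
(`klDiv/(N+1)` is bounded uniformly in `s, N` by energy conservation). Since `RelEntropyVanishing → S`
is LANDED (`EntropyInequalityStep_holds`, stmt-0769, + `HydrodynamicLimit.of_unguarded`), the crux is
the one-body / weak / in-mean / time-averaged shadow of a statement that already implies the summit. -/
def TargetDomination : Prop :=
  RelEntropyVanishing → OneBodyGaussianBound → LocalMaxwellianInMean

/-- CONVERSE (new observation of this census; typed target for a future support item).
**Hydrodynamics in LLN form forces Yau's entropy form, for deterministic dynamics.** Same binders as
the route target `RelEntropyVanishing`; hypothesis: the empirical fields at time `t` converge in
probability to Euler(t) (the conclusion of the conjunct for these data); conclusion: for some continuous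
positive activity profile `a` the specific relative entropy of the law at time `t` w.r.t. the local
Gibbs law `(a, u_t, θ_t)` vanishes. Road (equilibrium bookkeeping only, "B_eq"): Liouville ⇒
`S(law_t) = S(law_0)`; `log ψ_t(z) = Σ_i ℓ_t(z_i) − log 𝒵_t` with `ℓ_t(x,v) = α_t(x) + β_t(x)·v + γ_t(x)|v|²`
a linear functional of the three EMPIRICAL CONSERVED FIELDS, so `KL(law_t ‖ ν_t)/(N+1) =
(E_{ν_0}[avg ℓ_0] − (N+1)⁻¹log 𝒵_0) − (E_{law_t}[avg ℓ_t] − (N+1)⁻¹log 𝒵_t) → S_th[Euler(t)] − S_th[Euler(0)]`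
by the LLN at times `0` and `t` (uniform integrability from pathwise energy conservation + Gaussian initial
velocities) and the low-density thermodynamic limit of the inhomogeneous local-Gibbs partition functions
(`a_t` = activity with equilibrium density `ρ_t`, window of `HsEosLowDensity`), where
`S_th = ∫ρ[(3/2)log(2πθ) + 3/2 − log ρ − f_ex(ρσ³)]dx` is exactly the thermodynamic entropy whose Gibbs
relation has `p = hsPressure`, `e = 3θ/2` — conserved by CLASSICAL hs-Euler solutions (`Ds/Dt = 0`).
Hence the limit is `0`. With `EntropyInequalityStep_holds` (X_RE → S, landed) this makes the route target
EQUIVALENT to the conjunct modulo B_eq and the packing guard, and — through `TargetDomination` — makes the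
crux a CONSEQUENCE of (conjunct ∧ `OneBodyGaussianBound`). -/
def EntropyFromHydrodynamics : Prop :=
  ∀ (a₀ θ₀ : Literature.MathematicalPhysics.KineticTheory.T3 → ℝ) (u₀ : Literature.MathematicalPhysics.KineticTheory.T3 → Literature.MathematicalPhysics.KineticTheory.V3), Continuous a₀ → Continuous θ₀ → Continuous u₀ → (∀ x, 0 < a₀ x) → (∀ x, 0 < θ₀ x) → ∃ σ₀ : ℝ, 0 < σ₀ ∧ ∀ σ : ℝ, 0 < σ → σ < σ₀ → ∀ (T : ℝ) (ρ θ : ℝ → Literature.MathematicalPhysics.KineticTheory.T3 → ℝ) (u : ℝ → Literature.MathematicalPhysics.KineticTheory.T3 → Literature.MathematicalPhysics.KineticTheory.V3), Literature.MathematicalPhysics.KineticTheory.IsHardSphereEulerSolution σ T ρ u θ → ∀ Φ : (N : ℕ) → Literature.Analysis.FluidPDE.HardSphereFlow (Literature.Analysis.FluidPDE.Torus.geometry (Fin 3)) (Literature.MathematicalPhysics.KineticTheory.hsDiameter σ N) (N + 1), Literature.MathematicalPhysics.KineticTheory.TendstoHydroFieldsAt (fun N => Literature.MathematicalPhysics.KineticTheory.localGibbsLaw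 σ a₀ u₀ θ₀ N (Φ N)) Φ ρ u θ 0 → ∀ t ∈ Set.Ico 0 T,
    Literature.MathematicalPhysics.KineticTheory.TendstoHydroFieldsAt (fun N => Literature.MathematicalPhysics.KineticTheory.localGibbsLaw σ a₀ u₀ θ₀ N (Φ N)) Φ ρ u θ t →
    ∃ a : Literature.MathematicalPhysics.KineticTheory.T3 → ℝ, Continuous a ∧ (∀ x, 0 < a x) ∧
      Filter.Tendsto (fun N : ℕ => InformationTheory.klDiv ((Φ N).lawAt (Literature.MathematicalPhysics.KineticTheory.localGibbsLaw σ a₀ u₀ θ₀ N (Φ N)) t) (Literature.MathematicalPhysics.KineticTheory.localGibbsLaw σ a (u t) (θ t) N (Φ N)) / ((N : ENNReal) + 1)) Filter.atTop (nhds 0)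

/-- Sanity: the typed Boltzmann–Enskog route and the kinematic reduction compose with the domination
as pure logic (no mathematics claimed here). [folklore] -/
theorem targetDomination_of_pieces
    (hA : RelEntropyVanishing → OneBodyGaussianBound → VelocityMaxwellianityInMean)
    (hK : KinematicMaxwellianReduction) : TargetDomination :=
  fun hRE hOBG => hK (hA hRE hOBG) hOBG

end Summit.AtomisticToContinuum.HydrodynamicLimit.Cruxes.LocalMaxwellianInMean.Census
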